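import Summits.BirchSwinnertonDyer.BirchSwinnertonDyer.Theses.CMKolyvaginAtInertTwo
import Summits.BirchSwinnertonDyer.BirchSwinnertonDyer.Theorems.CMKolyvaginAtInertTwoCMExactDescentAtTwo
import HarnessLib

/-!
# Closer BY NAME of item 24154 `CMExactDescentAtTwoOfFacts` (route CMKolyvaginAtInertTwo, rev 3):
# the quadratic 2-descent of exactness, relative to its four published inputs

Seat `bsd-line-cmk2-p1` g2 (cell `bsd-print-cf2`). Summit-side THEOREM-ONLY file (one theorem; no
definition, no named fact, no `sorry`).

The route pen (bsd-idea-1 g2, rev 3) filed the twin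
`CMExactDescentAtTwoOfFacts := (GZ ∀N ∧ GZK-rank ∧ modularity ∧ Milne any-model) → CMExactDescentAtTwo`
of crux 22837 exactly as in the kernel-checked TURNKEY
`Cruxes/CMExactDescentAtTwo/TURNKEY_route_edit_22837.lean`. Its proof is ALREADY in the tree:
`Summit.BirchSwinnertonDyer.BirchSwinnertonDyer.Theorems.CMExactDescent.cmExactDescentAtTwo_ofFacts`
(p581565, bsd-line-cmk2-p1 g0; referee PASS 2026-08-27T23:34Z: literal by name, axioms standard,
CM hypotheses unused, M₀ seam closed in kernel). This file states the item's decl VERBATIM as the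
theorem's type and closes it by that constant. CONDITIONAL content: none beyond the item's own
antecedents (the four statement-only facts are hypotheses OF THE ITEM, not of this file).
BSD is not proved by this; beyond-print theorem: NO (Gross 1991 §2 + GZ86 V.(2.3) + Milne 1972 /
Dokchitser² bookkeeping, done in the kernel).
-/

set_option autoImplicit false

namespace Summit.BirchSwinnertonDyer.BirchSwinnertonDyer.Theorems

/-- **Item 24154 `CMExactDescentAtTwoOfFacts`, closed BY NAME**: granted Gross–Zagier at every level,
the GZK rank statement, modularity (entire `L`) and Milne's any-model quadratic base-change identity,
the exactness certificate `#Ш(E_K/K)[2^∞] = 4^{M₀}` over a Heegner field with odd `d_K ≠ −3` plus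
`BSD₂` of the globally minimal twin `E^{(d_K)}` descend to `BSD₂(E)` for every `E` in the habitat H₂
(in fact for every globally minimal `E` of analytic rank `1` with odd Tamagawa product and `ρ̄_{E,2}`
onto — the CM binders are idle). Proof: the tree constant `CMExactDescent.cmExactDescentAtTwo_ofFacts`.
[cite: GrossZagier1986, V.§2 (2.3)] [cite: GrossLMS1991, §2 (1.2)] [cite: Milne1972ArithmeticAV, §1 Thm. 1]
[cite: McCallumLMS1991, §5 Lemma 5.1] [cite: Miller2011LMS, Def. 1.1] -/
theorem cmExactDescentAtTwoOfFacts_proof :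
    Summit.BirchSwinnertonDyer.BirchSwinnertonDyer.Theses.CMKolyvaginAtInertTwo.CMExactDescentAtTwoOfFacts :=
  CMExactDescent.cmExactDescentAtTwo_ofFacts

end Summit.BirchSwinnertonDyer.BirchSwinnertonDyer.Theorems
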